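import Summits.Schanuel.Schanuel.Theses.RoyCriterion
import Literature.NumberTheory.Transcendental.RoySmallValueDistance

/-!
# Sketch (crux-ideate round 2, ideator 6) — crux `stmt-Schanuel-1050` `RoySmallValueDirichletGap`

Card `two-sided-absorption-transfer`.  Notation of Roy 2013 §7 (arXiv:1301.0663 p.18): `T = ⌊D^τ⌋`,
`Y = 2D^β`, `U = D^ν/2`, `δ = ν + τ − 2 − β > 0`, enemy `Z = Z_D` (0-dimensional, ℚ-irreducible,
`d = deg Z`, `h = h(Z)`), for `α ∈ Z(ℂ)`: `ρ_α = pdist`, `ε_α = adist` (tree: `Roy2013.pdist/adist`).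

* `max_rescale_le`, `max_mono_depth` — the two elementary inequalities that make Roy's Step-2 mass
  `M_Z(D) = −∑_{α∈𝒰} max(T log ρ_α, log ε_α)` propagate to EVERY level `D'`
  (down: factor `T'/T`; up: no loss).  PROVED.
* `TwoSidedAbsorptionBookkeeping` — the real-analysis core of the FREE-ASCENT / TWO-SIDED STRONG
  ABSORPTION lemma: with Roy's Step-2 lower bound `M ≥ (D^δ/25)(D^β d + D h) + D h` at the single
  level `D`, the height of `Z` relative to `𝒞_{D'}` is negative for all
  `D' ∈ [25^{1/(τ−1)} D^{1−δ/(τ−1)}, (1/125)^{1/β} D^{1+δ/β}]`, because the propagated mass beats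
  `D' h + 4 d D'^β + d D'` (= `D' h(Z)` plus the junk `d·(Y' + O(D'))` of Props 2.3/4.2) resp. the cap
  `U' = D'^ν/2` does.  Dictionary: by Roy's Prop. 2.3 (second part) a negative relative height forces
  EVERY integer point of `𝒞_{D'}` to vanish on `Z_D` — on a two-sided polynomial range of levels, not
  only at `D` (Roy) — and the lower end is exactly Roy's bound `D* ≪ D^{1−δ/(τ−1)}` (Step 5, first
  inequality), obtained here without Step 4.  Stated as a `Prop` (true; proof = `nlinarith`-level real
  bookkeeping in the style of `Roy2013.endgame_step`).
* `crux_iff'` — read-back of the crux (costume guard: nothing below restates it).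
-/

noncomputable section

namespace Summit.Schanuel.Schanuel.Cruxes.RoySmallValueDirichletGap.SketchIdeator6

open Real Filter
open Summit.Schanuel.Schanuel.Theses.RoyCriterion (RoySmallValueDirichletGap)

/-- DESCENT propagation of one point's Step-2 term: for `0 ≤ T' ≤ T`, `log ρ ≤ 0`, `log ε ≤ 0`,
`max(T' log ρ, log ε) ≤ (T'/T) · max(T log ρ, log ε)`.  [folklore; used with Roy2013 §7 Step 2] -/
theorem max_rescale_le {T T' lρ lε : ℝ} (hT : 0 < T) (hTT : T' ≤ T) (hT' : 0 ≤ T') (hρ : lρ ≤ 0)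
    (hε : lε ≤ 0) : max (T' * lρ) lε ≤ (T' / T) * max (T * lρ) lε := by
  have hq0 : 0 ≤ T' / T := div_nonneg hT' hT.le
  have hq1 : T' / T ≤ 1 := (div_le_one hT).mpr hTT
  have h1 : (T' / T) * (T * lρ) = T' * lρ := by field_simp
  have h2 : lε ≤ (T' / T) * lε := by nlinarith
  calc max (T' * lρ) lε ≤ max (T' * lρ) ((T' / T) * lε) := max_le_max le_rfl h2
    _ = max ((T' / T) * (T * lρ)) ((T' / T) * lε) := by rw [h1]
    _ = (T' / T) * max (T * lρ) lε := (mul_max_of_nonneg _ _ hq0).symm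

/-- ASCENT propagation: for `T ≤ T'` and `log ρ ≤ 0`, `max(T' log ρ, log ε) ≤ max(T log ρ, log ε)`
(more derivatives only make the point "closer").  [folklore] -/
theorem max_mono_depth {T T' lρ lε : ℝ} (hTT : T ≤ T') (hρ : lρ ≤ 0) :
    max (T' * lρ) lε ≤ max (T * lρ) lε :=
  max_le_max (by nlinarith) le_rfl

/-- **Two-sided strong absorption — the bookkeeping core (First lemma of the card).**
For `1 < τ < β`, `δ > 0`, eventually in `D`: whenever `1 ≤ d ≤ D^{2−τ}`, `0 ≤ h ≤ 3D^{1+β−τ}`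
(Prop. 6.4 at level `D`) and `M ≥ (D^δ/25)(D^β d + D h) + D h` (Roy's Step 2), then
(descent) for `25^{1/(τ−1)} D^{1−δ/(τ−1)} ≤ D' ≤ D`: `(D'/D)^τ · M ≥ D' h + 4 d D'^β + d D'`, and
(ascent) for `D ≤ D' ≤ (1/125)^{1/β} D^{1+δ/β}`: `min M (D'^ν/2) ≥ D' h + 4 d D'^β + d D'`, `ν = 2+β−τ+δ`.
Via `max_rescale_le` / `max_mono_depth` and Roy's Props 2.3, 4.2, 4.5 this says `h_{𝒞_{D'}}(Z_D) < 0`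
on the whole range, hence (Prop 2.3, part 2) every `P ∈ ℤ[X]_{D'} ∩ 𝒞_{D'}` vanishes on `Z_D`.
[cite: Roy2013, §7 Steps 2–3, Props 2.3, 4.2, 4.5; this two-sided form is NEW] -/
def TwoSidedAbsorptionBookkeeping : Prop :=
  ∀ β τ δ : ℝ, 1 < τ → τ < β → 0 < δ →
    ∀ᶠ D : ℝ in atTop, ∀ d h M D' : ℝ,
      1 ≤ d → d ≤ D ^ (2 - τ) → 0 ≤ h → h ≤ 3 * D ^ (1 + β - τ) →
      (D ^ δ / 25) * (D ^ β * d + D * h) + D * h ≤ M →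
      ((25 : ℝ) ^ (1 / (τ - 1)) * D ^ (1 - δ / (τ - 1)) ≤ D' → D' ≤ D →
          D' * h + 4 * d * D' ^ β + d * D' ≤ (D' / D) ^ τ * M) ∧
      (D ≤ D' → D' ≤ (1 / 125 : ℝ) ^ (1 / β) * D ^ (1 + δ / β) →
          D' * h + 4 * d * D' ^ β + d * D' ≤ min M (D' ^ (2 + β - τ + δ) / 2))

/-- The two distances of Roy §4 are the tree's `pdist` / `adist` (read-back of the dictionary used in
the card: `ρ_α = pdist ξ η α`, `ε_α = adist ξ η α`). -/
example (ξ η : ℂ) (α : Fin 3 → ℂ) : 0 ≤ Literature.NumberTheory.Transcendental.Roy2013.pdist ξ η α ∧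
    0 ≤ Literature.NumberTheory.Transcendental.Roy2013.adist ξ η α :=
  ⟨Literature.NumberTheory.Transcendental.Roy2013.pdist_nonneg ξ η α,
   Literature.NumberTheory.Transcendental.Roy2013.adist_nonneg ξ η α⟩

/-- Read-back of the crux (guard: the card's stubs never restate this). -/
theorem crux_iff' : RoySmallValueDirichletGap ↔
    ∀ (ξ η : ℂ), η ≠ 0 → ∀ (β τ ν : ℝ), 1 ≤ τ → τ < 2 → τ < β → 2 + β - τ < ν →
      (∀ᶠ D : ℕ in Filter.atTop, ∃ P : MvPolynomial (Fin 2) ℤ, P ≠ 0 ∧ P.totalDegree ≤ D ∧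
        (Literature.NumberTheory.Transcendental.mvPolyHeight P : ℝ) ≤ Real.exp ((D : ℝ) ^ β) ∧
        ∀ i : ℕ, i < 3 * ⌊(D : ℝ) ^ τ⌋₊ →
          ‖MvPolynomial.aeval ![ξ, η] (Literature.NumberTheory.Transcendental.royD^[i] P)‖ ≤
            Real.exp (-(D : ℝ) ^ ν)) →
      IsAlgebraic ℚ ξ ∧ IsAlgebraic ℚ η := Iff.rfl

end Summit.Schanuel.Schanuel.Cruxes.RoySmallValueDirichletGap.SketchIdeator6

end
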